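import Summits.ValiantsHypothesis.ValiantsHypothesis.Theorems.KPlusLogSqLawStaticTridiagonalFourByFour

/-!
# Static definite tridiagonal designs: the CLASS RANGE, counted (all sizes) — Part 7

HONEST FRAMING.  Helper theorem (`--supports stmt-ValiantsHypothesis-19561 --as helper`; seat val-sym-lift-p2 g9, cell `pub-symmetroid`,
2026-08-27), typing the bookkeeping fact used (on paper) throughout Parts 2–6: at a positive determinant zero of a static definite
tridiagonal design (no proper leading minor vanishing) at most `⌊m/2⌋ − 1` LDLᵀ pivots are negative, so the zero's inertia class is one of
`0, …, ⌊m/2⌋ − 1` (for even `m = 2n`: classes `0 … n−1`, the two extreme ones carrying ≤ 2 zeros each by Parts 2 and 3b).  Structure only;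
nothing here bears on `WeakLifting` (stmt-19561) / `TropicalB` (stmt-19771) in their windows, Conjecture B, the Door-A registers,
`MatrixDescartes` (stmt-ValiantsHypothesis-18050) or VP ≠ VNP; α status NO MOVER.

WHAT IS PROVED.  `card_le_of_no_adjacent` (a subset of `{1,…,L}` without two consecutive integers has ≤ `⌈L/2⌉` elements) and
**`card_negPivots_le_of_root`** (the count above, from Part 6's `pivot_pos_of_prev_neg` / `prevPivot_pos_of_root`).
[folklore; this seat's Part 6.]
-/

set_option linter.dupNamespace false
set_option autoImplicit false

namespace Summit.ValiantsHypothesis.ValiantsHypothesis.Theorems.KPlusLogSqLaw.DefiniteInterpolation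

open Summit.ValiantsHypothesis.ValiantsHypothesis.Theorems.ValuativeFlip (ctK ctK_zero ctK_one)

/-! ### The class range, counted (all sizes): a positive determinant zero has at most `⌊m/2⌋ − 1` negative pivots -/

section ClassCount

/-- **Non-adjacent subsets of `{1, …, L}` have at most `⌈L/2⌉` elements** (`k ↦ (k+1)/2` is injective on them). [folklore] -/
theorem card_le_of_no_adjacent (L : ℕ) (S : Finset ℕ) (hS : ∀ k ∈ S, 1 ≤ k ∧ k ≤ L)
    (hadj : ∀ k ∈ S, k + 1 ∉ S) : S.card ≤ (L + 1) / 2 := by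
  have hinj : Set.InjOn (fun k : ℕ => (k + 1) / 2) (S : Set ℕ) := by
    intro k hk k' hk' hkk'
    simp only [Finset.mem_coe] at hk hk'
    simp only at hkk'
    by_contra hne
    rcases Nat.lt_or_gt_of_ne hne with h | h
    · have : k' = k + 1 := by omega
      exact hadj k hk (this ▸ hk')
    · have : k = k' + 1 := by omega
      exact hadj k' hk' (this ▸ hk)
  calc S.card = (S.image fun k : ℕ => (k + 1) / 2).card := (Finset.card_image_of_injOn hinj).symm
    _ ≤ (Finset.Icc 1 ((L + 1) / 2)).card := by
        refine Finset.card_le_card fun j hj => ?_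
        rw [Finset.mem_image] at hj
        obtain ⟨k, hk, rfl⟩ := hj
        have := hS k hk
        rw [Finset.mem_Icc]
        omega
    _ = (L + 1) / 2 := by simp

variable {m : ℕ} (c : Fin m → Fin m → ℝ) (e : Fin m → Fin m → ℕ)

/-- **CLASS RANGE (all sizes): at a positive determinant zero of a static definite tridiagonal design at which no proper leading minor
vanishes, at most `⌊m/2⌋ − 1` of the LDLᵀ pivots `K_{k+1}/K_k` (`k < m`) are negative** — i.e. (Jacobi) the singular matrix has at most
`⌊m/2⌋ − 1` negative eigenvalues, so the inertia classes are `0, …, ⌊m/2⌋ − 1`.  (The first pivot is `d₁ > 0`, the last is `0`, the one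
before it is positive by `prevPivot_pos_of_root`, and no two consecutive ones are negative by `pivot_pos_of_prev_neg`.) [this file] -/
theorem card_negPivots_le_of_root (hc : ∀ i j, c i j = c j i) (hpos : ∀ i, 0 < c i i) {t : ℝ} (ht : 0 < t) (hm : 2 ≤ m)
    (hK : ∀ k < m, ctK (fun s : ℕ => if h : s < m then c ⟨s, h⟩ ⟨s, h⟩ * t ^ e ⟨s, h⟩ ⟨s, h⟩ else 1)
        (fun s : ℕ => -(if h : s + 1 < m then c ⟨s, by omega⟩ ⟨s + 1, h⟩ * t ^ e ⟨s, by omega⟩ ⟨s + 1, h⟩ else 0))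
        (fun s : ℕ => if h : 1 ≤ s ∧ s < m then c ⟨s, h.2⟩ ⟨s - 1, by omega⟩ * t ^ e ⟨s, h.2⟩ ⟨s - 1, by omega⟩ else 0) k ≠ 0)
    (hroot : ctK (fun s : ℕ => if h : s < m then c ⟨s, h⟩ ⟨s, h⟩ * t ^ e ⟨s, h⟩ ⟨s, h⟩ else 1)
        (fun s : ℕ => -(if h : s + 1 < m then c ⟨s, by omega⟩ ⟨s + 1, h⟩ * t ^ e ⟨s, by omega⟩ ⟨s + 1, h⟩ else 0))
        (fun s : ℕ => if h : 1 ≤ s ∧ s < m then c ⟨s, h.2⟩ ⟨s - 1, by omega⟩ * t ^ e ⟨s, h.2⟩ ⟨s - 1, by omega⟩ else 0) m = 0) :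
    ((Finset.range m).filter (fun k => ctK (fun s : ℕ => if h : s < m then c ⟨s, h⟩ ⟨s, h⟩ * t ^ e ⟨s, h⟩ ⟨s, h⟩ else 1)
        (fun s : ℕ => -(if h : s + 1 < m then c ⟨s, by omega⟩ ⟨s + 1, h⟩ * t ^ e ⟨s, by omega⟩ ⟨s + 1, h⟩ else 0))
        (fun s : ℕ => if h : 1 ≤ s ∧ s < m then c ⟨s, h.2⟩ ⟨s - 1, by omega⟩ * t ^ e ⟨s, h.2⟩ ⟨s - 1, by omega⟩ else 0) (k + 1) /
        ctK (fun s : ℕ => if h : s < m then c ⟨s, h⟩ ⟨s, h⟩ * t ^ e ⟨s, h⟩ ⟨s, h⟩ else 1)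
        (fun s : ℕ => -(if h : s + 1 < m then c ⟨s, by omega⟩ ⟨s + 1, h⟩ * t ^ e ⟨s, by omega⟩ ⟨s + 1, h⟩ else 0))
        (fun s : ℕ => if h : 1 ≤ s ∧ s < m then c ⟨s, h.2⟩ ⟨s - 1, by omega⟩ * t ^ e ⟨s, h.2⟩ ⟨s - 1, by omega⟩ else 0) k < 0)).card ≤ m / 2 - 1 := by
  obtain ⟨j, hj⟩ : ∃ j, m = j + 2 := ⟨m - 2, by omega⟩
  set S := (Finset.range m).filter (fun k => ctK (fun s : ℕ => if h : s < m then c ⟨s, h⟩ ⟨s, h⟩ * t ^ e ⟨s, h⟩ ⟨s, h⟩ else 1)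
        (fun s : ℕ => -(if h : s + 1 < m then c ⟨s, by omega⟩ ⟨s + 1, h⟩ * t ^ e ⟨s, by omega⟩ ⟨s + 1, h⟩ else 0))
        (fun s : ℕ => if h : 1 ≤ s ∧ s < m then c ⟨s, h.2⟩ ⟨s - 1, by omega⟩ * t ^ e ⟨s, h.2⟩ ⟨s - 1, by omega⟩ else 0) (k + 1) /
        ctK (fun s : ℕ => if h : s < m then c ⟨s, h⟩ ⟨s, h⟩ * t ^ e ⟨s, h⟩ ⟨s, h⟩ else 1)
        (fun s : ℕ => -(if h : s + 1 < m then c ⟨s, by omega⟩ ⟨s + 1, h⟩ * t ^ e ⟨s, by omega⟩ ⟨s + 1, h⟩ else 0))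
        (fun s : ℕ => if h : 1 ≤ s ∧ s < m then c ⟨s, h.2⟩ ⟨s - 1, by omega⟩ * t ^ e ⟨s, h.2⟩ ⟨s - 1, by omega⟩ else 0) k < 0) with hS
  have hmem : ∀ k, k ∈ S ↔ k < m ∧ ctK (fun s : ℕ => if h : s < m then c ⟨s, h⟩ ⟨s, h⟩ * t ^ e ⟨s, h⟩ ⟨s, h⟩ else 1)
        (fun s : ℕ => -(if h : s + 1 < m then c ⟨s, by omega⟩ ⟨s + 1, h⟩ * t ^ e ⟨s, by omega⟩ ⟨s + 1, h⟩ else 0))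
        (fun s : ℕ => if h : 1 ≤ s ∧ s < m then c ⟨s, h.2⟩ ⟨s - 1, by omega⟩ * t ^ e ⟨s, h.2⟩ ⟨s - 1, by omega⟩ else 0) (k + 1) /
        ctK (fun s : ℕ => if h : s < m then c ⟨s, h⟩ ⟨s, h⟩ * t ^ e ⟨s, h⟩ ⟨s, h⟩ else 1)
        (fun s : ℕ => -(if h : s + 1 < m then c ⟨s, by omega⟩ ⟨s + 1, h⟩ * t ^ e ⟨s, by omega⟩ ⟨s + 1, h⟩ else 0))
        (fun s : ℕ => if h : 1 ≤ s ∧ s < m then c ⟨s, h.2⟩ ⟨s - 1, by omega⟩ * t ^ e ⟨s, h.2⟩ ⟨s - 1, by omega⟩ else 0) k < 0 := by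
    intro k; rw [hS, Finset.mem_filter, Finset.mem_range]
  have h0 : 0 ∉ S := by
    rw [hmem]; rintro ⟨-, h⟩
    rw [ctK_one, ctK_zero, div_one] at h
    exact absurd h (not_lt.mpr (diagSeq_pos c e hpos ht 0).le)
  have hlast : m - 1 ∉ S := by
    rw [hmem]; rintro ⟨-, h⟩
    rw [show m - 1 + 1 = m by omega, hroot, zero_div] at h
    exact lt_irrefl 0 h
  have hprev : m - 2 ∉ S := by
    rw [hmem]; rintro ⟨-, h⟩
    have hp := prevPivot_pos_of_root c e hc hpos ht j (by rw [← hj]; exact hroot) (hK (j + 1) (by omega)) (hK j (by omega))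
    rw [show m - 2 + 1 = j + 1 by omega, show m - 2 = j by omega] at h
    linarith
  have hadj : ∀ k ∈ S, k + 1 ∉ S := by
    intro k hk hk1
    rw [hmem] at hk hk1
    have := pivot_pos_of_prev_neg c e hc hpos ht k hk.2
    rw [show k + 2 = k + 1 + 1 from rfl] at this
    linarith [hk1.2]
  have hrange : ∀ k ∈ S, 1 ≤ k ∧ k ≤ m - 3 := by
    intro k hk
    have hk' := (hmem k).mp hk
    refine ⟨?_, ?_⟩
    · by_contra h; have : k = 0 := by omega
      exact h0 (this ▸ hk)
    · by_contra h
      rcases Nat.lt_or_ge k (m - 1) with h1 | h1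
      · have : k = m - 2 := by omega
        exact hprev (this ▸ hk)
      · have : k = m - 1 := by omega
        exact hlast (this ▸ hk)
  have := card_le_of_no_adjacent (m - 3) S hrange hadj
  omega

end ClassCount

end Summit.ValiantsHypothesis.ValiantsHypothesis.Theorems.KPlusLogSqLaw.DefiniteInterpolation
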